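import Summits.Ventures.CertifiedManyBodySolver.Transport.PauliMarkovMatrixSigma
import HarnessLib

/-!
# Ventures/CertifiedManyBodySolver — Transport/PauliMarkovMatrixDensity.lean

HONEST FRAMING: first certified bounds; not a superconductivity verdict; every number certified or labelled float.

The PMP slack forms of `Transport/PauliMarkovMatrixSigma.lean` with the spin density supplied BY VALUE.
A certificate computes op-02's rhs `h(Λ) = (2π)^{-d} ∫ σ_{C(ν)}(Λ̂(k)) dk` (`pmpValue ν S Λ`) at a
NUMERICAL `ν` (half the filling, `ν = n/2`), while LEMMA PMP bounds the row by `pmpValue (spinDensity ω τ) S Λ`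
with the spin density `ω(n_{0τ})` of the state at hand. On the state classes used by the cell's
thermodynamic-limit nodes the two agree by hypothesis: class (I) of `ℤ²`
(`Literature/…/HubbardSquareTorusLimitState.lean`: `ω(n_{0σ}) = n/2` for torus limits of `S^z = 0` sector
ground states) and the spin-symmetric variational class (`Literature/…/HubbardSpinSymmetricStates.lean`).
This file turns such a hypothesis `ω(n_{0τ}) = ν` into `spinDensity ω τ = ν` (`spinDensity_eq_of_expect_nAt`)
and restates the operator bound and the slack forms with `pmpValue ν` (`re_expect_pmpOp_le_pmpValue_of_expect_nAt`,
`re_expect_pmpSigmaSlack_nonneg_of_expect_nAt`, `re_expect_sub_pmpSigmaSlack_le_of_expect_nAt`) — the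
by-name shape of a PMP rung's soundness sentence: "`B_i ≥ pmpValue (n/2) S_i Λ_i` (reader's Arb leg) and
`ω(n_{0τ_i}) = n/2` (node hypothesis) ⇒ `Re ω(X − Σ_i κ_i (B_i 𝟙 − O_{Λ_i})) ≤ Re ω(X)`".

No physical notion is defined, no named fact, no sorry.

References: op-02 PM-2D.md §7.4–7.6 (`C(ρ)`, `ω(n_{x,−σ}) = ρ`).
-/

noncomputable section

namespace Summit.Ventures.CertifiedManyBodySolver.Transport

open Matrix Finset MeasureTheory
open Literature.Probability.LatticeModels
open Literature.MathematicalPhysics.QuantumLattice HubbardWave0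
open scoped ComplexOrder Real

variable {d : ℕ} (ω : InfVolFermionState d) (σ τ : Fin 2)

/-- **Spin density by value**: if `ω(n_{0τ}) = ν` (as a complex number) then `spinDensity ω τ = ν`. -/
theorem spinDensity_eq_of_expect_nAt {ν : ℝ}
    (h : ω.expect {0} (nAt 0 (Finset.mem_singleton_self 0) τ) = ((ν : ℝ) : ℂ)) : spinDensity ω τ = ν := by
  rw [spinDensity, ← ω.expect_nAt_eq_twoPoint τ (Finset.mem_singleton_self (0 : Site d)), h, Complex.ofReal_re]

/-- The spin density may be read off in any region containing `0`. -/
theorem spinDensity_eq_of_expect_nAt' {ν : ℝ} {Λ : Finset (Site d)} (h0 : (0 : Site d) ∈ Λ)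
    (h : ω.expect Λ (nAt 0 h0 τ) = ((ν : ℝ) : ℂ)) : spinDensity ω τ = ν := by
  rw [spinDensity, ← ω.expect_nAt_eq_twoPoint τ h0, h, Complex.ofReal_re]

/-- **Operator form with the spin density by value**: `ω(n_{0τ}) = ν ⇒ Re ω(O_Λ) ≤ pmpValue ν S Λ`. -/
theorem re_expect_pmpOp_le_pmpValue_of_expect_nAt (hω : ω.IsTranslationInvariant) (hστ : σ ≠ τ) {ν : ℝ}
    (hν : ω.expect {0} (nAt 0 (Finset.mem_singleton_self 0) τ) = ((ν : ℝ) : ℂ)) (S : Finset (Site d))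
    (Lam : Site d → Matrix (Fin 2) (Fin 2) ℂ) (Λ : Finset (Site d)) (h0 : (0 : Site d) ∈ Λ)
    (hmem : ∀ r ∈ S, r ∈ Λ) :
    (ω.expect Λ (pmpOp S Lam σ τ Λ h0 hmem)).re ≤ pmpValue ν S Lam := by
  rw [← spinDensity_eq_of_expect_nAt ω τ hν]
  exact re_expect_pmpOp_le_pmpValue ω σ τ hω hστ S Lam Λ h0 hmem

/-- **Slack form with the spin densities by value** (PMP rows `(σ_i, τ_i, S_i, Λ^{(i)})`, `κ_i ≥ 0`,
node hypotheses `ω(n_{0τ_i}) = ν_i`, reader's bounds `pmpValue ν_i S_i Λ^{(i)} ≤ B_i`):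
`0 ≤ Re ω(Σ_i κ_i (B_i 𝟙 − O_{Λ^{(i)}}))`. -/
theorem re_expect_pmpSigmaSlack_nonneg_of_expect_nAt (hω : ω.IsTranslationInvariant) {Λ : Finset (Site d)}
    (h0 : (0 : Site d) ∈ Λ) {ι : Type*} (s : Finset ι) (σ τ : ι → Fin 2) (hστ : ∀ i ∈ s, σ i ≠ τ i)
    (ν : ι → ℝ) (hν : ∀ i ∈ s, ω.expect {0} (nAt 0 (Finset.mem_singleton_self 0) (τ i)) = ((ν i : ℝ) : ℂ))
    (S : ι → Finset (Site d)) (Lam : ι → Site d → Matrix (Fin 2) (Fin 2) ℂ) (hmem : ∀ i, ∀ r ∈ S i, r ∈ Λ)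
    (κ B : ι → ℝ) (hκ : ∀ i ∈ s, 0 ≤ κ i) (hB : ∀ i ∈ s, pmpValue (ν i) (S i) (Lam i) ≤ B i) :
    0 ≤ (ω.expect Λ (∑ i ∈ s, ((κ i : ℝ) : ℂ) •
      (((B i : ℝ) : ℂ) • (1 : FermionOp Λ) - pmpOp (S i) (Lam i) (σ i) (τ i) Λ h0 (hmem i)))).re :=
  re_expect_pmpSigmaSlack_nonneg ω hω h0 s σ τ hστ S Lam hmem κ B hκ fun i hi => by
    rw [spinDensity_eq_of_expect_nAt ω (τ i) (hν i hi)]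
    exact hB i hi

/-- The same in difference form: `Re ω(X − Σ_i κ_i (B_i 𝟙 − O_{Λ^{(i)}})) ≤ Re ω(X)`. -/
theorem re_expect_sub_pmpSigmaSlack_le_of_expect_nAt (hω : ω.IsTranslationInvariant) {Λ : Finset (Site d)}
    (h0 : (0 : Site d) ∈ Λ) {ι : Type*} (s : Finset ι) (σ τ : ι → Fin 2) (hστ : ∀ i ∈ s, σ i ≠ τ i)
    (ν : ι → ℝ) (hν : ∀ i ∈ s, ω.expect {0} (nAt 0 (Finset.mem_singleton_self 0) (τ i)) = ((ν i : ℝ) : ℂ))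
    (S : ι → Finset (Site d)) (Lam : ι → Site d → Matrix (Fin 2) (Fin 2) ℂ) (hmem : ∀ i, ∀ r ∈ S i, r ∈ Λ)
    (κ B : ι → ℝ) (hκ : ∀ i ∈ s, 0 ≤ κ i) (hB : ∀ i ∈ s, pmpValue (ν i) (S i) (Lam i) ≤ B i)
    (X : FermionOp Λ) :
    (ω.expect Λ (X - ∑ i ∈ s, ((κ i : ℝ) : ℂ) •
      (((B i : ℝ) : ℂ) • (1 : FermionOp Λ) - pmpOp (S i) (Lam i) (σ i) (τ i) Λ h0 (hmem i)))).re ≤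
      (ω.expect Λ X).re := by
  rw [map_sub, Complex.sub_re]
  linarith [re_expect_pmpSigmaSlack_nonneg_of_expect_nAt ω hω h0 s σ τ hστ ν hν S Lam hmem κ B hκ hB]

end Summit.Ventures.CertifiedManyBodySolver.Transport

end
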